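import Summits.CriticalPhenomena.PercolationContinuityZ3.Theorems.PercNearOneGluingNoHeavyLowerTailAntiBandCylinder
import Summits.CriticalPhenomena.PercolationContinuityZ3.Theorems.PercNearOneGluingNoHeavyLowerTailAntiBandShift
import Summits.CriticalPhenomena.PercolationContinuityZ3.Theorems.PercNearOneGluingNoHeavyLowerTailAntiBandShiftReduction

/-!
# `NoHeavyLowerTail` (crux stmt-CriticalPhenomena-4575), lane prim-ineq-gen-4 (gen 34): dominated cylinder partitions give (AB_l) for ALL upper sets `V`

Support file (`--supports stmt-CriticalPhenomena-4575`; memo `run/shared/lean/prim/prim-ineq-gen-4/FINDING-CYLINDER-g34.md` §1–2).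
No definitions, no `sorry`, standard axioms.

* `sum_lt_sum_compression` : the element-sum measure `Σ_{s∈V} Σ_{a∈s} a` strictly increases under a genuine compression along `({j},{i})`, `i < j`
  (a right shift).
* `antiBand_of_forall_rightShifted` : if `W` is a LEFT-shifted family (compressed along `({i},{j})` for all `i < j`) and (AB_l)(W, V') holds for every
  RIGHT-shifted upper set `V'`, then (AB_l)(W, V) holds for every upper set `V` — iterate gen 20's opposite-compression lemma
  `AntiBandShift.antiBand_compression_swap_le`, which leaves `W` fixed.
* `antiBand_of_dominated_cylinders_all` : hence a left-shifted `W` whose outer part is partitioned by dominated cylinders (gen 34's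
  `AntiBandCylinder.antiBand_of_dominated_cylinders`) satisfies (AB_l) against EVERY upper set `V`, for every `l`.
-/

namespace Summit.CriticalPhenomena.PercolationContinuityZ3.Theorems.AntiBandCylinderShifted

open Finset
open scoped FinsetFamily

variable {n : ℕ}

/-- The element-sum measure strictly increases under a genuine compression along `({j},{i})` with `i < j` (each moved member has `i` replaced by `j`).
[folklore; cf. gen 21's `AntiBandShiftReduction.measure_compression_lt`] -/
theorem sum_lt_sum_compression {i j : Fin n} (hij : i < j) {A : Finset (Finset (Fin n))}
    (hne : 𝓒 ({j} : Finset (Fin n)) {i} A ≠ A) :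
    ∑ s ∈ A, ∑ a ∈ s, (a : ℕ) < ∑ s ∈ 𝓒 ({j} : Finset (Fin n)) {i} A, ∑ a ∈ s, (a : ℕ) := by
  classical
  rw [UV.compression] at hne ⊢
  have q : ∀ Q ∈ A.filter (fun s => UV.compress ({j} : Finset (Fin n)) {i} s ∉ A),
      UV.compress ({j} : Finset (Fin n)) {i} Q ≠ Q := by
    intro Q hQ h
    rw [mem_filter] at hQ
    apply hQ.2
    rw [h]
    exact hQ.1
  have uA : A.filter (fun s => UV.compress ({j} : Finset (Fin n)) {i} s ∈ A) ∪
      A.filter (fun s => UV.compress ({j} : Finset (Fin n)) {i} s ∉ A) = A := filter_union_filter_not_eq _ _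
  have ne₂ : (A.filter (fun s => UV.compress ({j} : Finset (Fin n)) {i} s ∉ A)).Nonempty := by
    rw [Finset.nonempty_iff_ne_empty]
    intro hemp
    apply hne
    rw [filter_image, hemp, image_empty, union_empty]
    conv_rhs => rw [← uA]
    rw [hemp, union_empty]
  rw [sum_union UV.compress_disjoint]
  conv_lhs => rw [← uA]
  rw [sum_union (disjoint_filter_filter_not _ _ _), add_lt_add_iff_left, filter_image, sum_image UV.compress_injOn]
  refine sum_lt_sum_of_nonempty ne₂ fun s hs => ?_
  -- a moved member: `compress s = insert j (s.erase i)` with `i ∈ s`, `j ∉ s`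
  have hmv := q s hs
  have hcond : Disjoint ({j} : Finset (Fin n)) s ∧ ({i} : Finset (Fin n)) ≤ s := by
    by_contra h
    exact hmv (by unfold UV.compress; rw [if_neg h])
  have hjs : j ∉ s := disjoint_singleton_left.1 hcond.1
  have his : i ∈ s := singleton_subset_iff.1 hcond.2
  have hc : UV.compress ({j} : Finset (Fin n)) {i} s = insert j (s.erase i) := by
    rw [UV.compress_of_disjoint_of_le hcond.1 hcond.2]
    ext x
    rw [mem_sdiff, sup_eq_union, mem_union, mem_singleton, mem_singleton, mem_insert, mem_erase]
    constructor
    · rintro ⟨h1 | h1, h2⟩; exacts [Or.inr ⟨h2, h1⟩, Or.inl h1]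
    · rintro (h1 | ⟨h1, h2⟩)
      exacts [⟨Or.inr h1, fun h => hjs (by rw [show j = i from h1.symm.trans h]; exact his)⟩, ⟨Or.inl h2, h1⟩]
  rw [hc, sum_insert (fun h => hjs (mem_of_mem_erase h)), ← add_sum_erase s (fun a => (a : ℕ)) his]
  have : (i : ℕ) < (j : ℕ) := hij
  omega

/-- **Reduction to right-shifted `V`.**  Let `W` be left-shifted (compressed along `({i},{j})` for all `i < j`).  If
`#{s ∈ W ∩ V'ᶜˢ | outer} ≤ #{s ∈ W ∩ V' | outer}` for every right-shifted upper set `V'` (compressed along `({j},{i})` for all `i < j`), then the same holds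
for every upper set `V`: compressing `V` along `({j},{i})` does not increase the functional (gen 20, `AntiBandShift.antiBand_compression_swap_le`, with `W`
fixed by the opposite compression), keeps `V` upper, and strictly increases the element-sum measure. [this work] -/
theorem antiBand_of_forall_rightShifted (l : ℕ) (W : Finset (Finset (Fin n)))
    (hW : ∀ i j : Fin n, i < j → UV.IsCompressed ({i} : Finset (Fin n)) {j} W)
    (h : ∀ V' : Finset (Finset (Fin n)), IsUpperSet (V' : Set (Finset (Fin n))) →
      (∀ i j : Fin n, i < j → UV.IsCompressed ({j} : Finset (Fin n)) {i} V') →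
      #((W ∩ V'ᶜˢ).filter fun s => #s < l ∨ #sᶜ < l) ≤ #((W ∩ V').filter fun s => #s < l ∨ #sᶜ < l))
    (V : Finset (Finset (Fin n))) (hV : IsUpperSet (V : Set (Finset (Fin n)))) :
    #((W ∩ Vᶜˢ).filter fun s => #s < l ∨ #sᶜ < l) ≤ #((W ∩ V).filter fun s => #s < l ∨ #sᶜ < l) := by
  classical
  -- the element-sum measure is bounded by `B := card (Finset (Fin n)) * (n * n)`; induct on `B − measure`
  set B : ℕ := Fintype.card (Finset (Fin n)) * (n * n) with hB
  have hbound : ∀ V : Finset (Finset (Fin n)), ∑ s ∈ V, ∑ a ∈ s, (a : ℕ) ≤ B := by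
    intro V
    calc ∑ s ∈ V, ∑ a ∈ s, (a : ℕ) ≤ ∑ s ∈ V, n * n := sum_le_sum fun s _ => by
            calc ∑ a ∈ s, (a : ℕ) ≤ ∑ a ∈ s, n := sum_le_sum fun a _ => a.2.le
              _ = #s * n := by rw [sum_const, smul_eq_mul]
              _ ≤ n * n := Nat.mul_le_mul_right n (by have := card_le_univ s; rwa [Fintype.card_fin] at this)
      _ = #V * (n * n) := by rw [sum_const, smul_eq_mul]
      _ ≤ B := Nat.mul_le_mul_right _ (card_le_univ V)
  suffices hmain : ∀ (k : ℕ) (V : Finset (Finset (Fin n))), B - (∑ s ∈ V, ∑ a ∈ s, (a : ℕ)) = k →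
      IsUpperSet (V : Set (Finset (Fin n))) →
      #((W ∩ Vᶜˢ).filter fun s => #s < l ∨ #sᶜ < l) ≤ #((W ∩ V).filter fun s => #s < l ∨ #sᶜ < l) from
    hmain _ V rfl hV
  intro k
  induction k using Nat.strong_induction_on with
  | _ k ih =>
    intro V hk hV
    by_cases hsh : ∀ i j : Fin n, i < j → UV.IsCompressed ({j} : Finset (Fin n)) {i} V
    · exact h V hV hsh
    · push Not at hsh
      obtain ⟨i, j, hij, hnc⟩ := hsh
      have hne : 𝓒 ({j} : Finset (Fin n)) {i} V ≠ V := hnc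
      set V' := 𝓒 ({j} : Finset (Fin n)) {i} V with hV'
      have hijne : i ≠ j := ne_of_lt hij
      have hV'up : IsUpperSet (V' : Set (Finset (Fin n))) := AntiBandShiftReduction.isUpperSet_compression_singleton hijne.symm hV
      have hlt : B - (∑ s ∈ V', ∑ a ∈ s, (a : ℕ)) < k := by
        have h1 : (∑ s ∈ V, ∑ a ∈ s, (a : ℕ)) < ∑ s ∈ V', ∑ a ∈ s, (a : ℕ) := sum_lt_sum_compression hij hne
        have h2 := hbound V'; rw [← hk]; omega
      have hrec := ih _ hlt V' rfl hV'up
      -- gen 20 Lemma 1 with `u = {i}`, `v = {j}`: `W` is fixed, `V ↦ V'`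
      have hdisj : Disjoint ({i} : Finset (Fin n)) {j} := disjoint_singleton.2 hijne
      have hL := AntiBandShift.antiBand_compression_swap_le hdisj (by rw [card_singleton, card_singleton]) l W V
      have hWfix : 𝓒 ({i} : Finset (Fin n)) {j} W = W := hW i j hij
      rw [hWfix] at hL
      have h1 : (0 : ℤ) ≤ (#((W ∩ V').filter fun s => #s < l ∨ #sᶜ < l) : ℤ) - #((W ∩ V'ᶜˢ).filter fun s => #s < l ∨ #sᶜ < l) := by
        have := hrec; omega
      have h2 := h1.trans hL
      omega

/-- **(AB_l) for a left-shifted `W` with a dominated cylinder partition, against EVERY upper set `V`.**  On `Fin n`: let `W` be compressed along `({i},{j})`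
for all `i < j`, and suppose its outer members (`#x < l ∨ #xᶜ < l`) are exactly the outer members of pairwise (outer-)disjoint cylinders `[p.1, p.2]`
(`p ∈ P`, `p.1 ⊆ p.2`), each with an injection `π_p : (p.2)ᶜ → p.1`, `i < π_p i`.  Then `#{s ∈ W ∩ Vᶜˢ | outer s} ≤ #{s ∈ W ∩ V | outer s}` for every
upper set `V`.  [this work: `AntiBandCylinder.antiBand_of_dominated_cylinders` + `antiBand_of_forall_rightShifted`] -/
theorem antiBand_of_dominated_cylinders_all (l : ℕ) (W : Finset (Finset (Fin n)))
    (hW : ∀ i j : Fin n, i < j → UV.IsCompressed ({i} : Finset (Fin n)) {j} W)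
    (P : Finset (Finset (Fin n) × Finset (Fin n)))
    (hP : ∀ p ∈ P, p.1 ⊆ p.2 ∧ ∃ π : Fin n → Fin n, (∀ i ∈ (p.2)ᶜ, π i ∈ p.1 ∧ i < π i) ∧ Set.InjOn π ↑(p.2)ᶜ)
    (hdisj : ∀ p ∈ P, ∀ p' ∈ P, p ≠ p' → ∀ x : Finset (Fin n), (#x < l ∨ #xᶜ < l) → p.1 ⊆ x → x ⊆ p.2 → p'.1 ⊆ x → x ⊆ p'.2 → False)
    (hcover : ∀ x : Finset (Fin n), (#x < l ∨ #xᶜ < l) → (x ∈ W ↔ ∃ p ∈ P, p.1 ⊆ x ∧ x ⊆ p.2))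
    (V : Finset (Finset (Fin n))) (hV : IsUpperSet (V : Set (Finset (Fin n)))) :
    #((W ∩ Vᶜˢ).filter fun s => #s < l ∨ #sᶜ < l) ≤ #((W ∩ V).filter fun s => #s < l ∨ #sᶜ < l) :=
  antiBand_of_forall_rightShifted l W hW
    (fun V' hV'up hV'sh => AntiBandCylinder.antiBand_of_dominated_cylinders l W V' hV'up hV'sh P hP hdisj hcover) V hV

end Summit.CriticalPhenomena.PercolationContinuityZ3.Theorems.AntiBandCylinderShifted
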